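/-
Copyright (c) 2026 the pub-hodgecm-mathlib formalisation cell (harness21).  Prover seat hodgecm-mathlib-F0P3b-p01 (g17): line LH3 (closer stub `stub_N9`), LETTER L1 clause (I₁),
brick (H-core) of LH5-p02 (g4)'s «THREE HANDS» plan (2026-09-02T10:57:48Z), layer L2 «(A5a′) `w₀` HELD OUT», part 2 — an EDITION of ★ (A5a) p851098 by the same lineage.
-/
import Literature.NumberTheory.Rogawski1990.ArchOrbFamGUnfoldedModel   -- ★ (A5a) p851098 (this lineage, g16): `orbFamG_eq_unfoldedModel_of_regG`, §0 `archRG_eq_prod_cpt_mul_prod_split`, `splitCoord_eq_add_half_add_half`; brings ★ (A2)+(A3) p851029, `orbFamG_apply`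
import Literature.NumberTheory.Rogawski1990.ArchChartOrbGHeldOut         -- part 1 (this seat): `chartOrbG_eq_prod_mul_integral_pi_prod_heldOut`, `chartOrbG_eq_prod_mul_integral_integral_heldOut_of_regG`
import HarnessLib

/-!
# (A5a′) THE UNFOLDED MODEL OF `orbFamG` WITH ONE COMPACT PLACE `w₀` HELD OUT («`{w ∉ S′} = {w₀} ⊔ rest`»; Rogawski 1990 §4.9, §8.2–8.3; Shelstad 1979 §4; Varadarajan 1977 I §1.12)

Topic `NumberTheory/Rogawski1990`; namespace `Literature.NumberTheory.Rogawski1990`.  THEOREMS ONLY (no `def`, no `instance`, no notation, no axiom, no named fact, no `sorry`);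
kernel lane `--kind proof --supports stmt-HodgeConjecture-24833`.  Cell `pub/hodgecm-mathlib`, crux H413 (`stmt-HodgeConjecture-24833`), F0∕P3c line LH3 (closer stub `stub_N9`),
LETTER L1 `HcOrbitalFamiliesStatement`, clause (I₁) «box descent at NON-GENERIC FACE POINTS» (B-desc′): LH5-p02 (g4)'s (H-core) needs the raw family `orbFamG` with the ONE compact
place `w₀` carrying the noncompact coincidence ISOLATED as an outer one-place quotient integral, the other places processed exactly as in ★ (A5a).  This file is that edition («ONE
EDITION ASK (A5a′) `w₀` HELD OUT», 2026-09-02T10:57:48Z), by the (A5a) lineage, on top of part 1 `ArchChartOrbGHeldOut` (the `chartOrbG` measure identity with `w₀` held out).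

CONVENTIONS as in part 1 (`W`, `U_w`, `T′_w`, `γ_w(c)`, `e`, `q_w = ν′_w ∕ t_w`; rest index `{w : {w // w ∉ S′} // w.1 ≠ w₀}` reading into ★ (A4′) with `e := fun w => w.1.1`; `M_rest`,
`X_rest`, `Q_rest`; the `w₀`-slot written with Mathlib `Function.update`).
* §3 **`orbFamG_eq_unfoldedModel_heldOut_of_regG`** — (A5a′): ★ (A5a) with the compact index split once more, `w₀` kept as the LOCAL quotient variable `x₀ : U_{w₀} ⧸ T′_{w₀}` in
  `descConj (gprimeBlockAt L α w₀ S′ (c w₀)) T′_{w₀} _ id` currency; measure `(⊗_{w∈S′} (κ ⊗ μ_N)) ⊗ (q_{w₀} ⊗ Q_rest)`; `a′` continuous, `c` `G`-regular.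
* §4 **`orbFamG_eq_integral_descConj_unfoldedModel_heldOut_of_regG`** — (A5a″) «`w₀` OUTSIDE, UNFOLDED INSIDE» for `a′ ∈ C_c(G′_∞)`:
  `orbFamG ν′ a′ S′ c = PREF(c) · ∫ x₀, descConj (γ_{w₀}(c)) T′_{w₀} _ (u ↦ ∫ a′ (e⁻¹ (update (SPLIT-unfolded ∣ REST)(c, y) w₀ u)) d((⊗ κ⊗μ_N) ⊗ Q_rest)) x₀ dq_{w₀}` — the inner integral IS
  (H-core)'s parametric test family `B(c, u)` on `U_{w₀}` (Fubini is done at the part-1 stage, where integrability is a transport; ★ (A2)+(A3) is applied INSIDE the outer integral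
  with spectator `X_rest`, so no integrability of the unfolded integrand is needed).
HONEST LABEL: HC_CM is proved only modulo the 7 printed citations (2 remaining named inputs: hLiu418 = `stmt-HodgeConjecture-24832`, h413 = `stmt-HodgeConjecture-24833`) until rung 0
closes; count-neutral letter-L1 plumbing.

## References
* [Rogawski1990] J. D. Rogawski, *Automorphic Representations of Unitary Groups in Three Variables*, Ann. of Math. Stud. 123 (1990), §4.9 (4.9.1)–(4.9.2) p. 55, §8.2 p. 122, §8.3 p. 124.
* [Shelstad1979] D. Shelstad, *Characters and inner forms of a quasi-split group over ℝ*, Compositio Math. 39 (1979), §4 pp. 22–24.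
* [Gelbart1975] S. Gelbart, *Automorphic Forms on Adele Groups*, Ann. of Math. Studies 83 (1975), §10 p. 155 (10.19); [Varadarajan1977] V. S. Varadarajan, *Harmonic Analysis on Real Reductive Groups*, LNM 576 (1977), Part I §1.12.
* [DeitmarEchterhoff2014] A. Deitmar, S. Echterhoff, *Principles of Harmonic Analysis*, 2nd ed. (2014), Thm. 1.5.3, Lemma 9.3.3; [Folland1995] G. B. Folland, *A Course in Abstract Harmonic Analysis* (1995), §2.6 (2.52).
-/

set_option autoImplicit false

noncomputable section
open MeasureTheory MeasureTheory.Measure Set NumberField NumberField.InfinitePlace Complex Topology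
open Literature.MeasureTheory.Group Literature.NumberTheory.Rogawski1990 Literature.NumberTheory.Automorphic Literature.NumberTheory.Automorphic.UnitaryGroup
open Literature.NumberTheory.Automorphic.ArchCartan
open scoped ContDiff Classical ENNReal NNReal MatrixGroups

namespace Literature.NumberTheory.Rogawski1990

/-! ## §3 (A5a′): the unfolded model of `orbFamG` on the `G`-regular set, `w₀` held out -/

section Assembly
variable (L : Type) [Field L] [NumberField L] [IsCMField L] (α : Fin 3 → L) (S' : Finset {w : InfinitePlace L // IsComplex w})
  [∀ w : {w : InfinitePlace L // IsComplex w}, MeasurableSpace ↥(archLocal L 3 (Matrix.diagonal α) w)]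
  [∀ w : {w : InfinitePlace L // IsComplex w}, BorelSpace ↥(archLocal L 3 (Matrix.diagonal α) w)]
  [∀ w : {w : InfinitePlace L // IsComplex w}, LocallyCompactSpace ↥(archLocal L 3 (Matrix.diagonal α) w)]
  [∀ w : {w : InfinitePlace L // IsComplex w}, SecondCountableTopology ↥(archLocal L 3 (Matrix.diagonal α) w)]
  [MeasurableSpace ↥(arch (↥(maximalRealSubfield L)) L (IsCMField.complexConj L) 3 (Matrix.diagonal α))]
  [BorelSpace ↥(arch (↥(maximalRealSubfield L)) L (IsCMField.complexConj L) 3 (Matrix.diagonal α))]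
  [∀ w : {w : InfinitePlace L // IsComplex w}, MeasurableSpace (↥(archLocal L 3 (Matrix.diagonal α) w) ⧸ chartTorusGLoc L α w S')]
  [∀ w : {w : InfinitePlace L // IsComplex w}, BorelSpace (↥(archLocal L 3 (Matrix.diagonal α) w) ⧸ chartTorusGLoc L α w S')]
  (ν'w : ∀ w : {w : InfinitePlace L // IsComplex w}, Measure ↥(archLocal L 3 (Matrix.diagonal α) w)) [∀ w, (ν'w w).IsHaarMeasure] [∀ w, (ν'w w).IsMulRightInvariant]
  (ν' : Measure ↥(arch (↥(maximalRealSubfield L)) L (IsCMField.complexConj L) 3 (Matrix.diagonal α))) [ν'.IsHaarMeasure] [ν'.IsMulRightInvariant]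
  (hν : ν' = (Measure.pi ν'w).map (archPiEquivCM 3 L (Matrix.diagonal α)).symm)
  (t : ∀ w : {w : InfinitePlace L // IsComplex w}, Measure ↥(chartTorusGLoc L α w S')) [∀ w, (t w).IsHaarMeasure] [∀ w, (t w).IsInvInvariant]
  -- the held-out compact place `w₀ ∉ S′` and the rest factor (as in §1)
  {w₀ : {w : InfinitePlace L // IsComplex w}} (hw₀ : w₀ ∉ S')
  [MeasurableSpace ((∀ w : {w : {w : {w : InfinitePlace L // IsComplex w} // w ∉ S'} // w.1 ≠ w₀}, ↥(archLocal L 3 (Matrix.diagonal α) w.1.1)) ⧸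
    Subgroup.pi Set.univ (fun w : {w : {w : {w : InfinitePlace L // IsComplex w} // w ∉ S'} // w.1 ≠ w₀} => chartTorusGLoc L α w.1.1 S'))]
  [BorelSpace ((∀ w : {w : {w : {w : InfinitePlace L // IsComplex w} // w ∉ S'} // w.1 ≠ w₀}, ↥(archLocal L 3 (Matrix.diagonal α) w.1.1)) ⧸
    Subgroup.pi Set.univ (fun w : {w : {w : {w : InfinitePlace L // IsComplex w} // w ∉ S'} // w.1 ≠ w₀} => chartTorusGLoc L α w.1.1 S'))]
  (ρrest : Measure ↥(Subgroup.pi Set.univ (fun w : {w : {w : {w : InfinitePlace L // IsComplex w} // w ∉ S'} // w.1 ≠ w₀} => chartTorusGLoc L α w.1.1 S')))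
  [ρrest.IsHaarMeasure] [ρrest.IsInvInvariant]
  (hρ : Measure.map (subgroupPiCoords fun w : {w : {w : {w : InfinitePlace L // IsComplex w} // w ∉ S'} // w.1 ≠ w₀} => chartTorusGLoc L α w.1.1 S') ρrest =
    Measure.pi fun w : {w : {w : {w : InfinitePlace L // IsComplex w} // w ∉ S'} // w.1 ≠ w₀} => t w.1.1)
  -- the standard split group `U(J₃)(ℂ)` and the per-place transports (★ (A2)), as in ★ (A5a)
  {J : Matrix (Fin 3) (Fin 3) ℂ} (hJ : J = (StdForm.antidiagonal 3).over ℂ)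
  [MeasurableSpace ↥(unitaryGroupOfForm (starRingEnd ℂ) J)] [BorelSpace ↥(unitaryGroupOfForm (starRingEnd ℂ) J)]
  [MeasurableSpace (↥(unitaryGroupOfForm (starRingEnd ℂ) J) ⧸ torusU (starRingEnd ℂ) J)] [BorelSpace (↥(unitaryGroupOfForm (starRingEnd ℂ) J) ⧸ torusU (starRingEnd ℂ) J)]
  (φ : ∀ w : {w : {w : InfinitePlace L // IsComplex w} // w ∈ S'}, ↥(archLocal L 3 (Matrix.diagonal α) w.1) ≃ₜ* ↥(unitaryGroupOfForm (starRingEnd ℂ) J))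
  (hφT : ∀ (w : {w : {w : InfinitePlace L // IsComplex w} // w ∈ S'}) (g : ↥(archLocal L 3 (Matrix.diagonal α) w.1)),
    (φ w).toMulEquiv g ∈ torusU (starRingEnd ℂ) J ↔ g ∈ chartTorusGLoc L α w.1 S')
  (hφd : ∀ (w : {w : {w : InfinitePlace L // IsComplex w} // w ∈ S'}) (cw : Fin 3 → ℝ),
    glDiagonal 3 ℂ (fun i => Units.mk0 (boostEig cw i) (boostEig_ne_zero cw i)) = ((φ w (gprimeBlockAt L α w.1 S' cw) : ↥(unitaryGroupOfForm (starRingEnd ℂ) J)) : GL (Fin 3) ℂ))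
  {K : Subgroup ↥(unitaryGroupOfForm (starRingEnd ℂ) J)} (κ : Measure ↥K) [SigmaFinite κ]
  (μN : Measure ↥(unipotentU (starRingEnd ℂ) J)) [IsHaarMeasure μN]
  {C : {w : {w : InfinitePlace L // IsComplex w} // w ∈ S'} → ℝ≥0}
  (hμC : ∀ w : {w : {w : InfinitePlace L // IsComplex w} // w ∈ S'},
    (quotientMeasure (chartTorusGLoc L α w.1 S') (t w.1) (isClosed_chartTorusGLoc L α w.1 S') (ν'w w.1)).map
        (cosetCongr (φ w).toMulEquiv (chartTorusGLoc L α w.1 S') (torusU (starRingEnd ℂ) J) (hφT w)) =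
      C w • Measure.map
        (fun p : ↥K × ↥(unipotentU (starRingEnd ℂ) J) =>
          (QuotientGroup.mk ((p.1 : ↥(unitaryGroupOfForm (starRingEnd ℂ) J)) * (p.2 : ↥(unitaryGroupOfForm (starRingEnd ℂ) J))) :
            ↥(unitaryGroupOfForm (starRingEnd ℂ) J) ⧸ torusU (starRingEnd ℂ) J))
        (κ.prod μN))
  -- the boost torus family on `U(J₃)(ℂ)` (★ `exists_torusU_boostEig_family`)
  (τ : (Fin 3 → ℝ) → ↥(unitaryGroupOfForm (starRingEnd ℂ) J)) (hτT : ∀ c, τ c ∈ torusU (starRingEnd ℂ) J)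
  (hτcoe : ∀ c, (((τ c : ↥(unitaryGroupOfForm (starRingEnd ℂ) J)) : GL (Fin 3) ℂ) : Matrix (Fin 3) (Fin 3) ℂ) = Matrix.diagonal (boostEig c))
  (hτmul : ∀ c c', τ (c + c') = τ c * τ c')
  (hτd : ∀ c, ∃ d : Fin 3 → ℂˣ, glDiagonal 3 ℂ d = ((τ c : ↥(unitaryGroupOfForm (starRingEnd ℂ) J)) : GL (Fin 3) ℂ) ∧ ∀ i, (d i : ℂ) = boostEig c i)

include hν hρ hw₀ hJ hφT hφd hμC hτT hτcoe hτmul hτd in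
/-- **(A5a′) THE UNFOLDED MODEL WITH THE COMPACT PLACE `w₀` HELD OUT.**  Same data as ★ (A5a) `orbFamG_eq_unfoldedModel_of_regG` (diagonal house frame `hα`, admissible `S′`,
product reading `hν` of the Haar measure `ν′`, inversion-invariant Haar measures `t_w` on the local chart tori, the split frames `φ_w` with `hφT`∕`hφd`, ONE compact `K ≤ U(J₃)(ℂ)` with
σ-finite `κ`, a Haar `μ_N`, the Iwasawa readings `hμC`, the boost torus family `τ`), plus a compact-chart place `w₀ ∉ S′` and an inversion-invariant Haar `ρ_rest` on
`M_rest := Π_{w ∉ S′, w ≠ w₀} T′_w` with coordinates `⊗ t_w` (`hρ`).  THEN for a continuous `a′` and every `G`-REGULAR `c`: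
**`orbFamG ν′ a′ S′ c = (∏_{w∉S′} (1−e^{i(φ−θ)})(1−e^{i(ψ−θ)})(1−e^{i(ψ−φ)})) · (∏_w t_w(B′_w)) · (∏_{w∈S′} C_w) ·
  ∫ a′ (e⁻¹ (update (w ↦ [w ∈ S′] φ_w⁻¹(k_w · τ(0,φ_w,θ_w) τ(x_w∕2,0,0) n_w τ(x_w∕2,0,0) · k_w⁻¹) ∣ [w ∉ S′, w ≠ w₀] (g γ_rest(c) g⁻¹)_w) w₀ (x₀ γ_{w₀}(c) x₀⁻¹)))
    d((⊗_{w∈S′} (κ ⊗ μ_N)) ⊗ ((ν′_{w₀}∕t_{w₀}) ⊗ ((⊗_rest ν′_w) ∕ ρ_rest)))(y, x₀, gM_rest)`**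
— the `w₀`-variable stays a LOCAL quotient variable `x₀ : U_{w₀} ⧸ T′_{w₀}` in `descConj (gprimeBlockAt L α w₀ S′ (c w₀)) T′_{w₀} _ id` currency (LH5-p02 (g4)'s (H-core) performs the
ONE-PLACE block descent there), the split places are unfolded to `K × N` exactly as in ★ (A5a), the remaining compact places form ONE quotient `X_rest` (what ★ (A4′) differentiates).
§1 + ★ (A2)+(A3) `prod_normaliser_smul_integral_pi_descConj_eq_smul_integral_pi_prod_symm` with spectator `Ω := (U_{w₀}⧸T′_{w₀}) × X_rest`. [cite: Rogawski1990, §4.9 (4.9.1)–(4.9.2) p. 55; §8.2 p. 122; §8.3 p. 124]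
[cite: Shelstad1979, §4 pp. 22–24] [cite: Gelbart1975, §10 p. 155 (10.19)] [cite: Varadarajan1977, I §1.12] -/
theorem orbFamG_eq_unfoldedModel_heldOut_of_regG (hα : ∀ i, α i ≠ 0) (hS' : ∀ w, w ∈ S' → w ∈ splitChartPlaces L α)
    (a' : ↥(arch (↥(maximalRealSubfield L)) L (IsCMField.complexConj L) 3 (Matrix.diagonal α)) → ℂ) (ha'c : Continuous a')
    {c : {w : InfinitePlace L // IsComplex w} → Fin 3 → ℝ} (hc : c ∈ RegG S') :
    orbFamG L α ν' a' S' c =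
      (∏ w ∈ Finset.univ.filter (fun w => w ∉ S'),
          ((1 - (Circle.exp (c w 1 - c w 0) : ℂ)) * (1 - (Circle.exp (c w 2 - c w 0) : ℂ)) * (1 - (Circle.exp (c w 2 - c w 1) : ℂ)))) *
        (∏ w, ((t w (chartBoxImgGLoc L α w S')).toReal : ℂ)) * ((∏ w : {w : {w : InfinitePlace L // IsComplex w} // w ∈ S'}, (C w : ℝ) : ℝ) : ℂ) *
        ∫ q : ({w : {w : InfinitePlace L // IsComplex w} // w ∈ S'} → ↥K × ↥(unipotentU (starRingEnd ℂ) J)) ×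
              ((↥(archLocal L 3 (Matrix.diagonal α) w₀) ⧸ chartTorusGLoc L α w₀ S') ×
                ((∀ w : {w : {w : {w : InfinitePlace L // IsComplex w} // w ∉ S'} // w.1 ≠ w₀}, ↥(archLocal L 3 (Matrix.diagonal α) w.1.1)) ⧸
                  Subgroup.pi Set.univ (fun w : {w : {w : {w : InfinitePlace L // IsComplex w} // w ∉ S'} // w.1 ≠ w₀} => chartTorusGLoc L α w.1.1 S'))),
          a' ((archPiEquivCM 3 L (Matrix.diagonal α)).symm (Function.update (fun w =>
            if h : w ∈ S' then
              (φ ⟨w, h⟩).symm (((q.1 ⟨w, h⟩).1 : ↥(unitaryGroupOfForm (starRingEnd ℂ) J)) *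
                (τ ![0, c w 1, c w 2] * τ ![c w 0 / 2, 0, 0] * ((q.1 ⟨w, h⟩).2 : ↥(unitaryGroupOfForm (starRingEnd ℂ) J)) * τ ![c w 0 / 2, 0, 0]) *
                ((q.1 ⟨w, h⟩).1 : ↥(unitaryGroupOfForm (starRingEnd ℂ) J))⁻¹)
            else if h₀ : w = w₀ then 1
            else
              descConj (fun w : {w : {w : {w : InfinitePlace L // IsComplex w} // w ∉ S'} // w.1 ≠ w₀} => gprimeBlock L α w.1.1 S' c)
                (Subgroup.pi Set.univ (fun w : {w : {w : {w : InfinitePlace L // IsComplex w} // w ∉ S'} // w.1 ≠ w₀} => chartTorusGLoc L α w.1.1 S'))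
                (forall_mem_pi_chartTorusGLoc_comm L α S' (fun w : {w : {w : {w : InfinitePlace L // IsComplex w} // w ∉ S'} // w.1 ≠ w₀} => w.1.1) c)
                (fun g => (g ⟨⟨w, h⟩, h₀⟩ : ↥(archLocal L 3 (Matrix.diagonal α) w))) q.2.2)
            w₀ (descConj (gprimeBlockAt L α w₀ S' (c w₀)) (chartTorusGLoc L α w₀ S') (forall_mem_chartTorusGLoc_comm L α w₀ S' (c w₀)) id q.2.1)))
          ∂((Measure.pi fun _ : {w : {w : InfinitePlace L // IsComplex w} // w ∈ S'} => κ.prod μN).prod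
            ((quotientMeasure (chartTorusGLoc L α w₀ S') (t w₀) (isClosed_chartTorusGLoc L α w₀ S') (ν'w w₀)).prod
              (quotientMeasure (Subgroup.pi Set.univ (fun w : {w : {w : {w : InfinitePlace L // IsComplex w} // w ∉ S'} // w.1 ≠ w₀} => chartTorusGLoc L α w.1.1 S')) ρrest
                (isClosed_coe_pi _ fun w => isClosed_chartTorusGLoc L α w.1.1 S')
                (Measure.pi fun w : {w : {w : {w : InfinitePlace L // IsComplex w} // w ∉ S'} // w.1 ≠ w₀} => ν'w w.1.1)))) := by
  refine (orbFamG_apply L α ν' a' hS' c).trans ((congrArg₂ (· * ·) (archRG_eq_prod_cpt_mul_prod_split S' c)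
    (chartOrbG_eq_prod_mul_integral_pi_prod_heldOut L α S' ν'w ν' hν t hw₀ ρrest hρ hα hS' a' c)).trans ?_)
  -- instances (as in ★ (A5a)): the local quotient measures are σ-finite, the rest data locally compact ∕ second countable ∕ s-finite
  haveI : ∀ w : {w : InfinitePlace L // IsComplex w}, SecondCountableTopology (↥(archLocal L 3 (Matrix.diagonal α) w) ⧸ chartTorusGLoc L α w S') := fun w => inferInstance
  haveI : ∀ w : {w : InfinitePlace L // IsComplex w},
      SigmaFinite (quotientMeasure (chartTorusGLoc L α w S') (t w) (isClosed_chartTorusGLoc L α w S') (ν'w w)) := fun w => inferInstance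
  have hMc : IsClosed ((Subgroup.pi Set.univ (fun w : {w : {w : {w : InfinitePlace L // IsComplex w} // w ∉ S'} // w.1 ≠ w₀} => chartTorusGLoc L α w.1.1 S')) :
      Set (∀ w : {w : {w : {w : InfinitePlace L // IsComplex w} // w ∉ S'} // w.1 ≠ w₀}, ↥(archLocal L 3 (Matrix.diagonal α) w.1.1))) :=
    isClosed_coe_pi _ fun w => isClosed_chartTorusGLoc L α w.1.1 S'
  haveI : LocallyCompactSpace ↥(Subgroup.pi Set.univ (fun w : {w : {w : {w : InfinitePlace L // IsComplex w} // w ∉ S'} // w.1 ≠ w₀} => chartTorusGLoc L α w.1.1 S')) :=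
    hMc.isClosedEmbedding_subtypeVal.locallyCompactSpace
  haveI : SecondCountableTopology ↥(Subgroup.pi Set.univ (fun w : {w : {w : {w : InfinitePlace L // IsComplex w} // w ∉ S'} // w.1 ≠ w₀} => chartTorusGLoc L α w.1.1 S')) :=
    TopologicalSpace.Subtype.secondCountableTopology _
  haveI : SFinite ρrest := inferInstance
  -- torus data on `U(J₃)(ℂ)`: `φ_w γ_w(c) = τ(c_w) = τ(0,θ,φ) τ(x∕2,0,0) τ(x∕2,0,0)`, diagonal units from `hτd`
  choose d hd hdc using hτd
  have hγt : ∀ w : {w : {w : InfinitePlace L // IsComplex w} // w ∈ S'}, (φ w) (gprimeBlockAt L α w.1 S' (c w.1)) = τ (c w.1) := fun w => by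
    apply Subtype.ext
    apply Units.ext
    rw [← hφd w (c w.1), coe_glDiagonal, hτcoe]
    rfl
  have htms : ∀ w : {w : {w : InfinitePlace L // IsComplex w} // w ∈ S'},
      τ (c w.1) = τ ![0, c w.1 1, c w.1 2] * τ ![c w.1 0 / 2, 0, 0] * τ ![c w.1 0 / 2, 0, 0] := fun w => by
    conv_lhs => rw [splitCoord_eq_add_half_add_half (c w.1)]
    rw [hτmul, hτmul]
  -- the recombined integrand is continuous in (split variables, (w₀-class, rest class))
  have hFc : Continuous fun p : (∀ w : {w : {w : InfinitePlace L // IsComplex w} // w ∈ S'}, ↥(archLocal L 3 (Matrix.diagonal α) w.1)) ×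
      ((↥(archLocal L 3 (Matrix.diagonal α) w₀) ⧸ chartTorusGLoc L α w₀ S') ×
        ((∀ w : {w : {w : {w : InfinitePlace L // IsComplex w} // w ∉ S'} // w.1 ≠ w₀}, ↥(archLocal L 3 (Matrix.diagonal α) w.1.1)) ⧸
          Subgroup.pi Set.univ (fun w : {w : {w : {w : InfinitePlace L // IsComplex w} // w ∉ S'} // w.1 ≠ w₀} => chartTorusGLoc L α w.1.1 S'))) =>
      a' ((archPiEquivCM 3 L (Matrix.diagonal α)).symm (Function.update (fun w =>
        if h : w ∈ S' then p.1 ⟨w, h⟩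
        else if h₀ : w = w₀ then 1
        else
          descConj (fun w : {w : {w : {w : InfinitePlace L // IsComplex w} // w ∉ S'} // w.1 ≠ w₀} => gprimeBlock L α w.1.1 S' c)
            (Subgroup.pi Set.univ (fun w : {w : {w : {w : InfinitePlace L // IsComplex w} // w ∉ S'} // w.1 ≠ w₀} => chartTorusGLoc L α w.1.1 S'))
            (forall_mem_pi_chartTorusGLoc_comm L α S' (fun w : {w : {w : {w : InfinitePlace L // IsComplex w} // w ∉ S'} // w.1 ≠ w₀} => w.1.1) c)
            (fun g => (g ⟨⟨w, h⟩, h₀⟩ : ↥(archLocal L 3 (Matrix.diagonal α) w))) p.2.2)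
        w₀ (descConj (gprimeBlockAt L α w₀ S' (c w₀)) (chartTorusGLoc L α w₀ S') (forall_mem_chartTorusGLoc_comm L α w₀ S' (c w₀)) id p.2.1))) := by
    refine ha'c.comp ((archPiEquivCM 3 L (Matrix.diagonal α)).symm.continuous.comp ((continuous_pi fun w => ?_).update w₀
      ((continuous_descConj _ _ _ continuous_id).comp (continuous_fst.comp continuous_snd))))
    by_cases h : w ∈ S'
    · simp only [dif_pos h]
      exact (continuous_apply _).comp continuous_fst
    · by_cases h₀ : w = w₀
      · simp only [dif_neg h, dif_pos h₀]
        exact continuous_const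
      · simp only [dif_neg h, dif_neg h₀]
        exact (continuous_descConj _ _ _ (continuous_apply _)).comp (continuous_snd.comp continuous_snd)
  have hB := prod_normaliser_smul_integral_pi_descConj_eq_smul_integral_pi_prod_symm hJ
    (fun w : {w : {w : InfinitePlace L // IsComplex w} // w ∈ S'} => chartTorusGLoc L α w.1 S')
    (fun w => quotientMeasure (chartTorusGLoc L α w.1 S') (t w.1) (isClosed_chartTorusGLoc L α w.1 S') (ν'w w.1)) φ hφT
    (fun _ => K) (fun _ => κ) (fun _ => μN) hμC (fun w => forall_mem_chartTorusGLoc_comm L α w.1 S' (c w.1)) hγt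
    (fun w => hτT _) (fun w => hτT _) htms (fun w => c w.1) (fun w => hc.2 w.1 w.2)
    (fun w => hd _) (fun w j => hdc _ j) (fun w => hd _) (fun w j => hdc _ j)
    ((quotientMeasure (chartTorusGLoc L α w₀ S') (t w₀) (isClosed_chartTorusGLoc L α w₀ S') (ν'w w₀)).prod
      (quotientMeasure (Subgroup.pi Set.univ (fun w : {w : {w : {w : InfinitePlace L // IsComplex w} // w ∉ S'} // w.1 ≠ w₀} => chartTorusGLoc L α w.1.1 S')) ρrest
        (isClosed_coe_pi _ fun w => isClosed_chartTorusGLoc L α w.1.1 S')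
        (Measure.pi fun w : {w : {w : {w : InfinitePlace L // IsComplex w} // w ∉ S'} // w.1 ≠ w₀} => ν'w w.1.1))) _ hFc
  beta_reduce at hB
  linear_combination ((∏ w ∈ Finset.univ.filter (fun w => w ∉ S'),
      ((1 - (Circle.exp (c w 1 - c w 0) : ℂ)) * (1 - (Circle.exp (c w 2 - c w 0) : ℂ)) * (1 - (Circle.exp (c w 2 - c w 1) : ℂ)))) *
    (∏ w, ((t w (chartBoxImgGLoc L α w S')).toReal : ℂ))) *
    ((congrArg₂ (· * ·) (Complex.ofReal_prod _ _).symm rfl).trans ((Complex.real_smul.symm.trans hB).trans Complex.real_smul))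

include hν hρ hw₀ hJ hφT hφd hμC hτT hτcoe hτmul hτd in
/-- **(A5a″) `w₀` OUTSIDE, UNFOLDED INSIDE — (H-core)'s parametric test family on `U_{w₀}` made explicit.**  Same data as (A5a′); for `a′ ∈ C_c(G′_∞)` and every `G`-REGULAR `c`:
**`orbFamG ν′ a′ S′ c = PREF(c) · ∫_{U_{w₀}⧸T′_{w₀}} descConj (gprimeBlockAt L α w₀ S′ (c w₀)) T′_{w₀} _ (u ↦ B(c, u)) x₀ d(ν′_{w₀}∕t_{w₀})(x₀)`** with
**`B(c, u) = ∫ a′ (e⁻¹ (update (w ↦ [w ∈ S′] φ_w⁻¹(k_w · τ(0,φ_w,θ_w) τ(x_w∕2,0,0) n_w τ(x_w∕2,0,0) · k_w⁻¹) ∣ [w ∉ S′, w ≠ w₀] (g γ_rest(c) g⁻¹)_w) w₀ u)) d((⊗_{w∈S′} (κ ⊗ μ_N)) ⊗ Q_rest)(y, gM_rest)`**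
and `PREF(c) = (∏_{w∉S′} signed compact factors) · (∏_w t_w(B′_w)) · (∏_{w∈S′} C_w)` — the `w₀`-place is an OUTER one-place orbital integral of the smooth family `u ↦ B(c, u)` on
`U_{w₀}`, as in the printed parabolic descent at one place.  Fubini is done at the §1 stage (§2, where integrability is a transport of ★ (A1) `integrable_comp_symm_archPiEquivCM_descConj_pi_of_regG`);
★ (A2)+(A3) is applied INSIDE the outer integral with spectator `X_rest` — no integrability of the unfolded integrand is used. [cite: Varadarajan1977, I §1.12]
[cite: Rogawski1990, §4.9 (4.9.1)–(4.9.2) p. 55; §8.2 p. 122; §8.3 p. 124] [cite: Shelstad1979, §4 pp. 22–24] [cite: DeitmarEchterhoff2014, Lemma 9.3.3] -/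
theorem orbFamG_eq_integral_descConj_unfoldedModel_heldOut_of_regG (hα : ∀ i, α i ≠ 0) (hS' : ∀ w, w ∈ S' → w ∈ splitChartPlaces L α)
    {a' : ↥(arch (↥(maximalRealSubfield L)) L (IsCMField.complexConj L) 3 (Matrix.diagonal α)) → ℂ} (ha'c : Continuous a') (ha's : HasCompactSupport a')
    {c : {w : InfinitePlace L // IsComplex w} → Fin 3 → ℝ} (hc : c ∈ RegG S') :
    orbFamG L α ν' a' S' c =
      (∏ w ∈ Finset.univ.filter (fun w => w ∉ S'),
          ((1 - (Circle.exp (c w 1 - c w 0) : ℂ)) * (1 - (Circle.exp (c w 2 - c w 0) : ℂ)) * (1 - (Circle.exp (c w 2 - c w 1) : ℂ)))) *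
        (∏ w, ((t w (chartBoxImgGLoc L α w S')).toReal : ℂ)) * ((∏ w : {w : {w : InfinitePlace L // IsComplex w} // w ∈ S'}, (C w : ℝ) : ℝ) : ℂ) *
        ∫ x₀ : ↥(archLocal L 3 (Matrix.diagonal α) w₀) ⧸ chartTorusGLoc L α w₀ S',
          descConj (gprimeBlockAt L α w₀ S' (c w₀)) (chartTorusGLoc L α w₀ S') (forall_mem_chartTorusGLoc_comm L α w₀ S' (c w₀))
            (fun u : ↥(archLocal L 3 (Matrix.diagonal α) w₀) =>
              ∫ q : ({w : {w : InfinitePlace L // IsComplex w} // w ∈ S'} → ↥K × ↥(unipotentU (starRingEnd ℂ) J)) ×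
                    ((∀ w : {w : {w : {w : InfinitePlace L // IsComplex w} // w ∉ S'} // w.1 ≠ w₀}, ↥(archLocal L 3 (Matrix.diagonal α) w.1.1)) ⧸
                      Subgroup.pi Set.univ (fun w : {w : {w : {w : InfinitePlace L // IsComplex w} // w ∉ S'} // w.1 ≠ w₀} => chartTorusGLoc L α w.1.1 S')),
                a' ((archPiEquivCM 3 L (Matrix.diagonal α)).symm (Function.update (fun w =>
                  if h : w ∈ S' then
                    (φ ⟨w, h⟩).symm (((q.1 ⟨w, h⟩).1 : ↥(unitaryGroupOfForm (starRingEnd ℂ) J)) *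
                      (τ ![0, c w 1, c w 2] * τ ![c w 0 / 2, 0, 0] * ((q.1 ⟨w, h⟩).2 : ↥(unitaryGroupOfForm (starRingEnd ℂ) J)) * τ ![c w 0 / 2, 0, 0]) *
                      ((q.1 ⟨w, h⟩).1 : ↥(unitaryGroupOfForm (starRingEnd ℂ) J))⁻¹)
                  else if h₀ : w = w₀ then 1
                  else
                    descConj (fun w : {w : {w : {w : InfinitePlace L // IsComplex w} // w ∉ S'} // w.1 ≠ w₀} => gprimeBlock L α w.1.1 S' c)
                      (Subgroup.pi Set.univ (fun w : {w : {w : {w : InfinitePlace L // IsComplex w} // w ∉ S'} // w.1 ≠ w₀} => chartTorusGLoc L α w.1.1 S'))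
                      (forall_mem_pi_chartTorusGLoc_comm L α S' (fun w : {w : {w : {w : InfinitePlace L // IsComplex w} // w ∉ S'} // w.1 ≠ w₀} => w.1.1) c)
                      (fun g => (g ⟨⟨w, h⟩, h₀⟩ : ↥(archLocal L 3 (Matrix.diagonal α) w))) q.2)
                  w₀ u))
                ∂((Measure.pi fun _ : {w : {w : InfinitePlace L // IsComplex w} // w ∈ S'} => κ.prod μN).prod
                  (quotientMeasure (Subgroup.pi Set.univ (fun w : {w : {w : {w : InfinitePlace L // IsComplex w} // w ∉ S'} // w.1 ≠ w₀} => chartTorusGLoc L α w.1.1 S')) ρrest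
                    (isClosed_coe_pi _ fun w => isClosed_chartTorusGLoc L α w.1.1 S')
                    (Measure.pi fun w : {w : {w : {w : InfinitePlace L // IsComplex w} // w ∉ S'} // w.1 ≠ w₀} => ν'w w.1.1))))
            x₀
          ∂(quotientMeasure (chartTorusGLoc L α w₀ S') (t w₀) (isClosed_chartTorusGLoc L α w₀ S') (ν'w w₀)) := by
  refine (orbFamG_apply L α ν' a' hS' c).trans ((congrArg₂ (· * ·) (archRG_eq_prod_cpt_mul_prod_split S' c)
    (chartOrbG_eq_prod_mul_integral_integral_heldOut_of_regG L α S' ν'w ν' hν t hw₀ ρrest hρ hα hS' hc ha'c ha's)).trans ?_)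
  -- instances (as in ★ (A5a))
  haveI : ∀ w : {w : InfinitePlace L // IsComplex w}, SecondCountableTopology (↥(archLocal L 3 (Matrix.diagonal α) w) ⧸ chartTorusGLoc L α w S') := fun w => inferInstance
  haveI : ∀ w : {w : InfinitePlace L // IsComplex w},
      SigmaFinite (quotientMeasure (chartTorusGLoc L α w S') (t w) (isClosed_chartTorusGLoc L α w S') (ν'w w)) := fun w => inferInstance
  have hMc : IsClosed ((Subgroup.pi Set.univ (fun w : {w : {w : {w : InfinitePlace L // IsComplex w} // w ∉ S'} // w.1 ≠ w₀} => chartTorusGLoc L α w.1.1 S')) :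
      Set (∀ w : {w : {w : {w : InfinitePlace L // IsComplex w} // w ∉ S'} // w.1 ≠ w₀}, ↥(archLocal L 3 (Matrix.diagonal α) w.1.1))) :=
    isClosed_coe_pi _ fun w => isClosed_chartTorusGLoc L α w.1.1 S'
  haveI : LocallyCompactSpace ↥(Subgroup.pi Set.univ (fun w : {w : {w : {w : InfinitePlace L // IsComplex w} // w ∉ S'} // w.1 ≠ w₀} => chartTorusGLoc L α w.1.1 S')) :=
    hMc.isClosedEmbedding_subtypeVal.locallyCompactSpace
  haveI : SecondCountableTopology ↥(Subgroup.pi Set.univ (fun w : {w : {w : {w : InfinitePlace L // IsComplex w} // w ∉ S'} // w.1 ≠ w₀} => chartTorusGLoc L α w.1.1 S')) :=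
    TopologicalSpace.Subtype.secondCountableTopology _
  haveI : SFinite ρrest := inferInstance
  -- torus data on `U(J₃)(ℂ)`: `φ_w γ_w(c) = τ(c_w) = τ(0,θ,φ) τ(x∕2,0,0) τ(x∕2,0,0)`, diagonal units from `hτd`
  choose d hd hdc using hτd
  have hγt : ∀ w : {w : {w : InfinitePlace L // IsComplex w} // w ∈ S'}, (φ w) (gprimeBlockAt L α w.1 S' (c w.1)) = τ (c w.1) := fun w => by
    apply Subtype.ext
    apply Units.ext
    rw [← hφd w (c w.1), coe_glDiagonal, hτcoe]
    rfl
  have htms : ∀ w : {w : {w : InfinitePlace L // IsComplex w} // w ∈ S'},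
      τ (c w.1) = τ ![0, c w.1 1, c w.1 2] * τ ![c w.1 0 / 2, 0, 0] * τ ![c w.1 0 / 2, 0, 0] := fun w => by
    conv_lhs => rw [splitCoord_eq_add_half_add_half (c w.1)]
    rw [hτmul, hτmul]
  -- ★ (A2)+(A3) INSIDE the outer integral: the unfolding of the split places, uniformly in the outer variable `x₀`
  have hinner : ∀ x₀ : ↥(archLocal L 3 (Matrix.diagonal α) w₀) ⧸ chartTorusGLoc L α w₀ S',
      (∏ w : ↥S', ((|Real.exp (c w 0) - Real.exp (-c w 0)| *
          ‖Complex.exp (c w 0 + c w 2 * I) - Complex.exp (c w 1 * I)‖ * ‖Complex.exp (-c w 0 + c w 2 * I) - Complex.exp (c w 1 * I)‖ : ℝ) : ℂ)) *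
          ∫ p : (∀ w : {w : {w : InfinitePlace L // IsComplex w} // w ∈ S'}, ↥(archLocal L 3 (Matrix.diagonal α) w.1) ⧸ chartTorusGLoc L α w.1 S') ×
              ((∀ w : {w : {w : {w : InfinitePlace L // IsComplex w} // w ∉ S'} // w.1 ≠ w₀}, ↥(archLocal L 3 (Matrix.diagonal α) w.1.1)) ⧸
            Subgroup.pi Set.univ (fun w : {w : {w : {w : InfinitePlace L // IsComplex w} // w ∉ S'} // w.1 ≠ w₀} => chartTorusGLoc L α w.1.1 S')),
            a' ((archPiEquivCM 3 L (Matrix.diagonal α)).symm (Function.update (fun w =>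
              if h : w ∈ S' then
                descConj (gprimeBlockAt L α w S' (c w)) (chartTorusGLoc L α w S') (forall_mem_chartTorusGLoc_comm L α w S' (c w)) id (p.1 ⟨w, h⟩)
              else if h₀ : w = w₀ then 1
              else
                descConj (fun w : {w : {w : {w : InfinitePlace L // IsComplex w} // w ∉ S'} // w.1 ≠ w₀} => gprimeBlock L α w.1.1 S' c)
                  (Subgroup.pi Set.univ (fun w : {w : {w : {w : InfinitePlace L // IsComplex w} // w ∉ S'} // w.1 ≠ w₀} => chartTorusGLoc L α w.1.1 S'))
                  (forall_mem_pi_chartTorusGLoc_comm L α S' (fun w : {w : {w : {w : InfinitePlace L // IsComplex w} // w ∉ S'} // w.1 ≠ w₀} => w.1.1) c)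
                  (fun g => (g ⟨⟨w, h⟩, h₀⟩ : ↥(archLocal L 3 (Matrix.diagonal α) w))) p.2)
            w₀ (descConj (gprimeBlockAt L α w₀ S' (c w₀)) (chartTorusGLoc L α w₀ S') (forall_mem_chartTorusGLoc_comm L α w₀ S' (c w₀)) id x₀)))
            ∂((Measure.pi fun w : {w : {w : InfinitePlace L // IsComplex w} // w ∈ S'} =>
                quotientMeasure (chartTorusGLoc L α w.1 S') (t w.1) (isClosed_chartTorusGLoc L α w.1 S') (ν'w w.1)).prod
              (quotientMeasure (Subgroup.pi Set.univ (fun w : {w : {w : {w : InfinitePlace L // IsComplex w} // w ∉ S'} // w.1 ≠ w₀} => chartTorusGLoc L α w.1.1 S')) ρrest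
            (isClosed_coe_pi _ fun w => isClosed_chartTorusGLoc L α w.1.1 S')
            (Measure.pi fun w : {w : {w : {w : InfinitePlace L // IsComplex w} // w ∉ S'} // w.1 ≠ w₀} => ν'w w.1.1))) =
        ((∏ w : {w : {w : InfinitePlace L // IsComplex w} // w ∈ S'}, (C w : ℝ) : ℝ) : ℂ) *
          ∫ q : ({w : {w : InfinitePlace L // IsComplex w} // w ∈ S'} → ↥K × ↥(unipotentU (starRingEnd ℂ) J)) ×
              ((∀ w : {w : {w : {w : InfinitePlace L // IsComplex w} // w ∉ S'} // w.1 ≠ w₀}, ↥(archLocal L 3 (Matrix.diagonal α) w.1.1)) ⧸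
            Subgroup.pi Set.univ (fun w : {w : {w : {w : InfinitePlace L // IsComplex w} // w ∉ S'} // w.1 ≠ w₀} => chartTorusGLoc L α w.1.1 S')),
            a' ((archPiEquivCM 3 L (Matrix.diagonal α)).symm (Function.update (fun w =>
              if h : w ∈ S' then
                (φ ⟨w, h⟩).symm (((q.1 ⟨w, h⟩).1 : ↥(unitaryGroupOfForm (starRingEnd ℂ) J)) *
                (τ ![0, c w 1, c w 2] * τ ![c w 0 / 2, 0, 0] * ((q.1 ⟨w, h⟩).2 : ↥(unitaryGroupOfForm (starRingEnd ℂ) J)) * τ ![c w 0 / 2, 0, 0]) *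
                ((q.1 ⟨w, h⟩).1 : ↥(unitaryGroupOfForm (starRingEnd ℂ) J))⁻¹)
              else if h₀ : w = w₀ then 1
              else
                descConj (fun w : {w : {w : {w : InfinitePlace L // IsComplex w} // w ∉ S'} // w.1 ≠ w₀} => gprimeBlock L α w.1.1 S' c)
                  (Subgroup.pi Set.univ (fun w : {w : {w : {w : InfinitePlace L // IsComplex w} // w ∉ S'} // w.1 ≠ w₀} => chartTorusGLoc L α w.1.1 S'))
                  (forall_mem_pi_chartTorusGLoc_comm L α S' (fun w : {w : {w : {w : InfinitePlace L // IsComplex w} // w ∉ S'} // w.1 ≠ w₀} => w.1.1) c)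
                  (fun g => (g ⟨⟨w, h⟩, h₀⟩ : ↥(archLocal L 3 (Matrix.diagonal α) w))) q.2)
            w₀ (descConj (gprimeBlockAt L α w₀ S' (c w₀)) (chartTorusGLoc L α w₀ S') (forall_mem_chartTorusGLoc_comm L α w₀ S' (c w₀)) id x₀)))
            ∂((Measure.pi fun _ : {w : {w : InfinitePlace L // IsComplex w} // w ∈ S'} => κ.prod μN).prod
              (quotientMeasure (Subgroup.pi Set.univ (fun w : {w : {w : {w : InfinitePlace L // IsComplex w} // w ∉ S'} // w.1 ≠ w₀} => chartTorusGLoc L α w.1.1 S')) ρrest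
            (isClosed_coe_pi _ fun w => isClosed_chartTorusGLoc L α w.1.1 S')
            (Measure.pi fun w : {w : {w : {w : InfinitePlace L // IsComplex w} // w ∉ S'} // w.1 ≠ w₀} => ν'w w.1.1))) := by
    intro x₀
    have hFc : Continuous fun p : (∀ w : {w : {w : InfinitePlace L // IsComplex w} // w ∈ S'}, ↥(archLocal L 3 (Matrix.diagonal α) w.1)) ×
        ((∀ w : {w : {w : {w : InfinitePlace L // IsComplex w} // w ∉ S'} // w.1 ≠ w₀}, ↥(archLocal L 3 (Matrix.diagonal α) w.1.1)) ⧸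
            Subgroup.pi Set.univ (fun w : {w : {w : {w : InfinitePlace L // IsComplex w} // w ∉ S'} // w.1 ≠ w₀} => chartTorusGLoc L α w.1.1 S')) =>
        a' ((archPiEquivCM 3 L (Matrix.diagonal α)).symm (Function.update (fun w =>
          if h : w ∈ S' then
            p.1 ⟨w, h⟩
          else if h₀ : w = w₀ then 1
          else
            descConj (fun w : {w : {w : {w : InfinitePlace L // IsComplex w} // w ∉ S'} // w.1 ≠ w₀} => gprimeBlock L α w.1.1 S' c)
              (Subgroup.pi Set.univ (fun w : {w : {w : {w : InfinitePlace L // IsComplex w} // w ∉ S'} // w.1 ≠ w₀} => chartTorusGLoc L α w.1.1 S'))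
              (forall_mem_pi_chartTorusGLoc_comm L α S' (fun w : {w : {w : {w : InfinitePlace L // IsComplex w} // w ∉ S'} // w.1 ≠ w₀} => w.1.1) c)
              (fun g => (g ⟨⟨w, h⟩, h₀⟩ : ↥(archLocal L 3 (Matrix.diagonal α) w))) p.2)
        w₀ (descConj (gprimeBlockAt L α w₀ S' (c w₀)) (chartTorusGLoc L α w₀ S') (forall_mem_chartTorusGLoc_comm L α w₀ S' (c w₀)) id x₀))) := by
      refine ha'c.comp ((archPiEquivCM 3 L (Matrix.diagonal α)).symm.continuous.comp ((continuous_pi fun w => ?_).update w₀ continuous_const))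
      by_cases h : w ∈ S'
      · simp only [dif_pos h]
        exact (continuous_apply _).comp continuous_fst
      · by_cases h₀ : w = w₀
        · simp only [dif_neg h, dif_pos h₀]
          exact continuous_const
        · simp only [dif_neg h, dif_neg h₀]
          exact (continuous_descConj _ _ _ (continuous_apply _)).comp continuous_snd
    have hB := prod_normaliser_smul_integral_pi_descConj_eq_smul_integral_pi_prod_symm hJ
      (fun w : {w : {w : InfinitePlace L // IsComplex w} // w ∈ S'} => chartTorusGLoc L α w.1 S')
      (fun w => quotientMeasure (chartTorusGLoc L α w.1 S') (t w.1) (isClosed_chartTorusGLoc L α w.1 S') (ν'w w.1)) φ hφT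
      (fun _ => K) (fun _ => κ) (fun _ => μN) hμC (fun w => forall_mem_chartTorusGLoc_comm L α w.1 S' (c w.1)) hγt
      (fun w => hτT _) (fun w => hτT _) htms (fun w => c w.1) (fun w => hc.2 w.1 w.2)
      (fun w => hd _) (fun w j => hdc _ j) (fun w => hd _) (fun w j => hdc _ j)
      (quotientMeasure (Subgroup.pi Set.univ (fun w : {w : {w : {w : InfinitePlace L // IsComplex w} // w ∉ S'} // w.1 ≠ w₀} => chartTorusGLoc L α w.1.1 S')) ρrest
            (isClosed_coe_pi _ fun w => isClosed_chartTorusGLoc L α w.1.1 S')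
            (Measure.pi fun w : {w : {w : {w : InfinitePlace L // IsComplex w} // w ∉ S'} // w.1 ≠ w₀} => ν'w w.1.1)) _ hFc
    exact (congrArg₂ (· * ·) (Complex.ofReal_prod _ _).symm rfl).trans ((Complex.real_smul.symm.trans hB).trans Complex.real_smul)
  have h1 := integral_congr_ae (μ := quotientMeasure (chartTorusGLoc L α w₀ S') (t w₀) (isClosed_chartTorusGLoc L α w₀ S') (ν'w w₀))
    (Filter.Eventually.of_forall hinner)
  have h2 := ((integral_const_mul _ _).symm.trans h1).trans (integral_const_mul _ _)
  -- the inner integral as a function of `u = x₀ γ_{w₀}(c) x₀⁻¹ ∈ U_{w₀}` (★ `descConj_mk`, class by class)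
  have h3 : ∀ x₀ : ↥(archLocal L 3 (Matrix.diagonal α) w₀) ⧸ chartTorusGLoc L α w₀ S',
      (∫ q : ({w : {w : InfinitePlace L // IsComplex w} // w ∈ S'} → ↥K × ↥(unipotentU (starRingEnd ℂ) J)) ×
              ((∀ w : {w : {w : {w : InfinitePlace L // IsComplex w} // w ∉ S'} // w.1 ≠ w₀}, ↥(archLocal L 3 (Matrix.diagonal α) w.1.1)) ⧸
            Subgroup.pi Set.univ (fun w : {w : {w : {w : InfinitePlace L // IsComplex w} // w ∉ S'} // w.1 ≠ w₀} => chartTorusGLoc L α w.1.1 S')),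
            a' ((archPiEquivCM 3 L (Matrix.diagonal α)).symm (Function.update (fun w =>
              if h : w ∈ S' then
                (φ ⟨w, h⟩).symm (((q.1 ⟨w, h⟩).1 : ↥(unitaryGroupOfForm (starRingEnd ℂ) J)) *
                (τ ![0, c w 1, c w 2] * τ ![c w 0 / 2, 0, 0] * ((q.1 ⟨w, h⟩).2 : ↥(unitaryGroupOfForm (starRingEnd ℂ) J)) * τ ![c w 0 / 2, 0, 0]) *
                ((q.1 ⟨w, h⟩).1 : ↥(unitaryGroupOfForm (starRingEnd ℂ) J))⁻¹)
              else if h₀ : w = w₀ then 1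
              else
                descConj (fun w : {w : {w : {w : InfinitePlace L // IsComplex w} // w ∉ S'} // w.1 ≠ w₀} => gprimeBlock L α w.1.1 S' c)
                  (Subgroup.pi Set.univ (fun w : {w : {w : {w : InfinitePlace L // IsComplex w} // w ∉ S'} // w.1 ≠ w₀} => chartTorusGLoc L α w.1.1 S'))
                  (forall_mem_pi_chartTorusGLoc_comm L α S' (fun w : {w : {w : {w : InfinitePlace L // IsComplex w} // w ∉ S'} // w.1 ≠ w₀} => w.1.1) c)
                  (fun g => (g ⟨⟨w, h⟩, h₀⟩ : ↥(archLocal L 3 (Matrix.diagonal α) w))) q.2)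
            w₀ (descConj (gprimeBlockAt L α w₀ S' (c w₀)) (chartTorusGLoc L α w₀ S') (forall_mem_chartTorusGLoc_comm L α w₀ S' (c w₀)) id x₀)))
            ∂((Measure.pi fun _ : {w : {w : InfinitePlace L // IsComplex w} // w ∈ S'} => κ.prod μN).prod
              (quotientMeasure (Subgroup.pi Set.univ (fun w : {w : {w : {w : InfinitePlace L // IsComplex w} // w ∉ S'} // w.1 ≠ w₀} => chartTorusGLoc L α w.1.1 S')) ρrest
            (isClosed_coe_pi _ fun w => isClosed_chartTorusGLoc L α w.1.1 S')
            (Measure.pi fun w : {w : {w : {w : InfinitePlace L // IsComplex w} // w ∉ S'} // w.1 ≠ w₀} => ν'w w.1.1)))) =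
        descConj (gprimeBlockAt L α w₀ S' (c w₀)) (chartTorusGLoc L α w₀ S') (forall_mem_chartTorusGLoc_comm L α w₀ S' (c w₀))
          (fun u : ↥(archLocal L 3 (Matrix.diagonal α) w₀) =>
            ∫ q : ({w : {w : InfinitePlace L // IsComplex w} // w ∈ S'} → ↥K × ↥(unipotentU (starRingEnd ℂ) J)) ×
                  ((∀ w : {w : {w : {w : InfinitePlace L // IsComplex w} // w ∉ S'} // w.1 ≠ w₀}, ↥(archLocal L 3 (Matrix.diagonal α) w.1.1)) ⧸
            Subgroup.pi Set.univ (fun w : {w : {w : {w : InfinitePlace L // IsComplex w} // w ∉ S'} // w.1 ≠ w₀} => chartTorusGLoc L α w.1.1 S')),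
              a' ((archPiEquivCM 3 L (Matrix.diagonal α)).symm (Function.update (fun w =>
                if h : w ∈ S' then
                  (φ ⟨w, h⟩).symm (((q.1 ⟨w, h⟩).1 : ↥(unitaryGroupOfForm (starRingEnd ℂ) J)) *
                (τ ![0, c w 1, c w 2] * τ ![c w 0 / 2, 0, 0] * ((q.1 ⟨w, h⟩).2 : ↥(unitaryGroupOfForm (starRingEnd ℂ) J)) * τ ![c w 0 / 2, 0, 0]) *
                ((q.1 ⟨w, h⟩).1 : ↥(unitaryGroupOfForm (starRingEnd ℂ) J))⁻¹)
                else if h₀ : w = w₀ then 1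
                else
                  descConj (fun w : {w : {w : {w : InfinitePlace L // IsComplex w} // w ∉ S'} // w.1 ≠ w₀} => gprimeBlock L α w.1.1 S' c)
                    (Subgroup.pi Set.univ (fun w : {w : {w : {w : InfinitePlace L // IsComplex w} // w ∉ S'} // w.1 ≠ w₀} => chartTorusGLoc L α w.1.1 S'))
                    (forall_mem_pi_chartTorusGLoc_comm L α S' (fun w : {w : {w : {w : InfinitePlace L // IsComplex w} // w ∉ S'} // w.1 ≠ w₀} => w.1.1) c)
                    (fun g => (g ⟨⟨w, h⟩, h₀⟩ : ↥(archLocal L 3 (Matrix.diagonal α) w))) q.2)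
              w₀ u))
              ∂((Measure.pi fun _ : {w : {w : InfinitePlace L // IsComplex w} // w ∈ S'} => κ.prod μN).prod
                (quotientMeasure (Subgroup.pi Set.univ (fun w : {w : {w : {w : InfinitePlace L // IsComplex w} // w ∉ S'} // w.1 ≠ w₀} => chartTorusGLoc L α w.1.1 S')) ρrest
            (isClosed_coe_pi _ fun w => isClosed_chartTorusGLoc L α w.1.1 S')
            (Measure.pi fun w : {w : {w : {w : InfinitePlace L // IsComplex w} // w ∉ S'} // w.1 ≠ w₀} => ν'w w.1.1))))
          x₀ := by
    intro x₀
    induction x₀ using QuotientGroup.induction_on with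
    | H g => rfl
  have h4 := h2.trans (congrArg (HMul.hMul _) (integral_congr_ae
    (μ := quotientMeasure (chartTorusGLoc L α w₀ S') (t w₀) (isClosed_chartTorusGLoc L α w₀ S') (ν'w w₀)) (Filter.Eventually.of_forall h3)))
  linear_combination ((∏ w ∈ Finset.univ.filter (fun w => w ∉ S'),
      ((1 - (Circle.exp (c w 1 - c w 0) : ℂ)) * (1 - (Circle.exp (c w 2 - c w 0) : ℂ)) * (1 - (Circle.exp (c w 2 - c w 1) : ℂ)))) *
    (∏ w, ((t w (chartBoxImgGLoc L α w S')).toReal : ℂ))) * h4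

end Assembly
end Literature.NumberTheory.Rogawski1990
end
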